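import Summits.MatrixMultiplication.MatrixMultiplication.Theorems.AbelianSTPPCensusTB5StatDefs

/-!
# T_B static certificate, range `5995 … 6012` (t*-indexed linear checker with the k-member tree at `τ = 2375/1000`): kernel evaluation, the completeness of the bucket lists, volumes `2001 … 2500` (small volume chunks: the kernel recursion through the long low-`t` lists is bounded per theorem)

Cell mm-stpp (rung F-M1), tier T_B = «beat `2.375` (Coppersmith–Winograd)»; checker in `AbelianSTPPCensusTB5StatDefs.lean`, table and bucket lists in `AbelianSTPPCensusTB5StatData.lean`
(pattern: theory g12's `AbelianSTPPCensusTAStatDDom*/DCk*.lean`).  `decide` with kernel reduction (standard axioms; no `native_decide`), `Elab.async false`;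
consumed by `TB5Stat.checkV_sound` / `TB5Stat.domV_sound` / `TB5Stat.m2V_sound` in the leaf `AbelianSTPPCensusLeafTB6012Closed.lean`.
WHAT THIS IS NOT: arithmetic on shape lists only; no statement about STPP families or `ω`.
-/

set_option linter.dupNamespace false
set_option autoImplicit false
set_option Elab.async false

namespace Summit.MatrixMultiplication.MatrixMultiplication.Theorems.TB5Stat

set_option maxHeartbeats 0 in
/-- Completeness chunk: every sorted candidate shape of the volumes `2001 … 2050` lies in the list of the bucket of its `a·b` (399 shapes). [original] -/
theorem m2c2001 : TB5Stat.m2V 50 2001 = true := by decide +kernel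

set_option maxHeartbeats 0 in
/-- Completeness chunk: every sorted candidate shape of the volumes `2051 … 2100` lies in the list of the bucket of its `a·b` (419 shapes). [original] -/
theorem m2c2051 : TB5Stat.m2V 50 2051 = true := by decide +kernel

set_option maxHeartbeats 0 in
/-- Completeness chunk: every sorted candidate shape of the volumes `2101 … 2150` lies in the list of the bucket of its `a·b` (380 shapes). [original] -/
theorem m2c2101 : TB5Stat.m2V 50 2101 = true := by decide +kernel

set_option maxHeartbeats 0 in
/-- Completeness chunk: every sorted candidate shape of the volumes `2151 … 2200` lies in the list of the bucket of its `a·b` (426 shapes). [original] -/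
theorem m2c2151 : TB5Stat.m2V 50 2151 = true := by decide +kernel

set_option maxHeartbeats 0 in
/-- Completeness chunk: every sorted candidate shape of the volumes `2201 … 2250` lies in the list of the bucket of its `a·b` (416 shapes). [original] -/
theorem m2c2201 : TB5Stat.m2V 50 2201 = true := by decide +kernel

set_option maxHeartbeats 0 in
/-- Completeness chunk: every sorted candidate shape of the volumes `2251 … 2300` lies in the list of the bucket of its `a·b` (392 shapes). [original] -/
theorem m2c2251 : TB5Stat.m2V 50 2251 = true := by decide +kernel

set_option maxHeartbeats 0 in
/-- Completeness chunk: every sorted candidate shape of the volumes `2301 … 2350` lies in the list of the bucket of its `a·b` (411 shapes). [original] -/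
theorem m2c2301 : TB5Stat.m2V 50 2301 = true := by decide +kernel

set_option maxHeartbeats 0 in
/-- Completeness chunk: every sorted candidate shape of the volumes `2351 … 2400` lies in the list of the bucket of its `a·b` (455 shapes). [original] -/
theorem m2c2351 : TB5Stat.m2V 50 2351 = true := by decide +kernel

set_option maxHeartbeats 0 in
/-- Completeness chunk: every sorted candidate shape of the volumes `2401 … 2450` lies in the list of the bucket of its `a·b` (405 shapes). [original] -/
theorem m2c2401 : TB5Stat.m2V 50 2401 = true := by decide +kernel

set_option maxHeartbeats 0 in
/-- Completeness chunk: every sorted candidate shape of the volumes `2451 … 2500` lies in the list of the bucket of its `a·b` (406 shapes). [original] -/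
theorem m2c2451 : TB5Stat.m2V 50 2451 = true := by decide +kernel

end Summit.MatrixMultiplication.MatrixMultiplication.Theorems.TB5Stat
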